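import Summits.QuantumFields.BalabanUV.Beta.D1BFx.LatticeHLSDamped

/-!
# `BalabanUV.Gaps.ProfileLegComposition` — cell `pub-balaban-gaps` (YM blitz Y1), track G1, seat g1-p1 (GEN 6), row (D1): **«PROFILE LEG COMPOSITION»** —
# the ENTRY PROFILE of a composite leg `comp K₁ K₂` (`ExpKernelCalculus.comp`: a `tsum` over the middle site and a finite fibre sum) from damped entry
# profiles of its factors: (C1) ONE SINGULAR CENTRE (`a ≤ d−1`) against a FLAT damped factor, either order — flat output, damped at half the rate,
# constant `B_{d,a}(ε)` (`≤ B_{d,a}(δ)·n^{d−a}` at `ε = δ∕n`); (C2) TWO SINGULAR CENTRES, SUPER-CRITICAL (`a, b ≤ d−1`, `a+b ≥ d+1`) — a damped profile of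
# exponent `a+b−d` again (lattice HLS); (C3) RIGHT (and left) DIFFERENCES COMMUTE WITH THE OTHER FACTOR; (C4) the ONE-POWER TRADE
# `nrm^{−b}·e^{−ε‖·‖} ≤ (1 + 2∕ε)·nrm^{−(b+1)}·e^{−(ε∕2)‖·‖}` turning a critical pair `a + b = d` into (C2) at `a + (b+1) = d + 1`.

WHY: b2b leaf-04 g26 W-1 (pub-balaban journal l.50800) COMMISSIONED these shapes (C1)–(C4) on this seat's ASK (INTENT I-gapsg1p1-14 l.50661) as
«GHOST-N8-SPEC v0.2 §3″ (O8) F3's GENERIC HALF» — named consumer leaf-04 (F3's instances `P∘G, G∘P, G∘(P∘G), G∘G` + right differences, then F5's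
twelve ghost-rest rows).  Outputs are in the hypothesis shape of `D1BFx/ProfileWordFamilies.abs_biBubble_le_of_profiles` (`κ ∕ nrm^a · e^{−ε‖·‖∞}`) so a
composite leg plugs into the (d1) letters BY NAME.  Engines (leaf-04's HLS kit, BY NAME): `LatticeHLSDamped.abs_sum_mul_le_of_damped_profiles` ∕
`abs_sum_mul_le_of_damped_flat`, `LatticeHLSPairing.abs_sum_fibre_mul_le`, `LatticeHLSProfiles.summable_and_abs_tsum_le_of_abs_sum_le`,
`LatticeHLSRadial.pow_mul_exp_neg_le`.
HONEST FRAMING (cell rule, page 1 of everything).  WHAT THIS IS: [folklore] `tsum`∕lattice-sum bookkeeping over ARBITRARY matrix kernels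
`K₁ K₂ : MKer d F` with every profile a DISPLAYED `∀`-hypothesis; no road object (`Ggh`, `Pgt`, columns) appears — the instances are leaf-04's F3.
WHAT THIS IS NOT: nothing of Bałaban's is asserted, used or discharged; no (1.22) row; no word bound; [B12] Thm 2 stays UNPROVED in print; binder (D1)
is NOT discharged; 0∕4 row-D1 binders; (K) NOT closed; NOT `BetaPertH`, NOT the continuum limit on ℝ⁴, NOT a mass gap, NOT Clay.
HONEST DEPENDENCY (cell records, verbatim): «continuum YM on T⁴ ⇐ BetaPertH ∧ nine spine estimates (0/9 proved); BetaPertH ⇐ (D1) ∧ (D4) ∧ CAP+tail;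
G-an2-4 gates asym, D1 and NE2/3/4.»  ABSOLUTE RULE (cell charter, verbatim): «No internally-minted statement may enter as a cited fact. Every
hypothesis is either kernel-proved in this package or a verbatim quotation of a PUBLISHED theorem with page reference.»  No `def`, no `def … : Prop`,
nothing cited as mathematics, 0 sorry, axioms ⊆ the standard trio.

CONTENT ([folklore]; `Site d = Fin d → ℤ`, `MKer d F`, `comp` from `ExpKernelCalculus`; `nrm = max(1,‖·‖∞)`, `supNorm` from `PoissonInterior`;
`C_d := d·2^{d+3}·9^{d−1}`, `B_{d,a}(ε) := 1 + 2d·3^{d−1}·((d−1−a)!·(4∕ε)^{d−1−a}·(1+4∕ε))`):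
* §0 `comp_eq_applyK` (`rfl`), `profile_mul_div_comm`, `exp_supNorm_sub_comm`, `exp_damp_mono`; §1 THE MAJORANT ENGINE `sum_abs_compTerm_le_of_majorants`
  ∕ **`summable_and_abs_comp_le_of_majorants`** (fibrewise majorants + a uniform bound on `Σ_{y∈S}|M₁M₂|` ⟹ middle sum summable, `|comp …| ≤ |F|·Bnd`).
* §2 (C2) **`abs_comp_le_of_profiles_super`**: `|comp K₁ K₂ x z g f| ≤ (|F|·κ₁·κ₂·C_d)∕nrm(x−z)^{a+b−d}·e^{−ε‖x−z‖∞}` (+ `summable_and_…_super`).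
* §3 (C1) **`abs_comp_le_of_profiles_singular_flat`** ∕ **`abs_comp_le_of_profiles_flat_singular`**: `≤ |F|·κ₁·κ₂·B_{d,·}(ε)·e^{−(ε∕2)‖x−z‖∞}` (`ε > 0`)
  (+ `summable_and_…` twins); scale-`n` readings `…_scale` (`ε = δ∕n`, `n ≥ 1`: `≤ (|F|·κ₁·κ₂·B_{d,·}(δ)·n^{d−·})∕nrm(x−z)^0·e^{−(δ∕2∕n)‖x−z‖∞}`).
* §4 (C3) **`comp_sub_right`**, **`comp_shift_sub_eq_comp_diff`** (`comp K₁ K₂ x (z+e) g f − comp K₁ K₂ x z g f = comp K₁ (D_e K₂) x z g f`),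
  `comp_shift_left_sub_eq_comp_diff`, under the two middle summabilities (§2∕§3 supply them).
* §5 (C4) **`profile_trade_one_power`** and **`abs_comp_le_of_profiles_crit_trade`** (`a ≤ d−1`, `b+1 ≤ d−1`, `a + b = d`):
  `|comp K₁ K₂ x z g f| ≤ (|F|·κ₁·(κ₂·(1+2∕ε))·C_d)∕nrm(x−z)^1·e^{−(ε∕2)‖x−z‖∞}`.
Unit `pub-balaban-gaps-g1-p1` (GEN 6), cell pub-balaban-gaps track G1 (binder (D1)); bus INTENT I-gapsg1p1-15; named consumer b2b leaf-04 g26 F3∕F5.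
-/

namespace Summit.QuantumFields.BalabanUV.Gaps.ProfileLegComposition

open Finset
open scoped BigOperators
open Literature.MathematicalPhysics.QuantumFieldTheory.Balaban1983to89.Beta
open ExpKernelCalculus (Site MKer comp)
open PoissonInterior (supNorm nrm nrm_pos nrm_neg supNorm_neg one_le_nrm supNorm_le_nrm)
open Summit.QuantumFields.BalabanUV.Beta.D1BFx
open Summit.QuantumFields.BalabanUV.Beta.D1BFx.LatticeHLSRadial (pow_mul_exp_neg_le)
open Summit.QuantumFields.BalabanUV.Beta.D1BFx.LatticeHLSProfiles (summable_and_abs_tsum_le_of_abs_sum_le)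
open Summit.QuantumFields.BalabanUV.Beta.D1BFx.LatticeHLSPairing (abs_sum_fibre_mul_le)
open Summit.QuantumFields.BalabanUV.Beta.D1BFx.LatticeHLSDamped (abs_sum_mul_le_of_damped_profiles abs_sum_mul_le_of_damped_flat)
open Summit.QuantumFields.BalabanUV.Beta.D1BFx.RankOneBubble (applyK)

noncomputable section

variable {d : ℕ} {F : Type*} [Fintype F]

/-! ## §0 The bridge to `applyK` and the two spellings of a profile -/

/-- [folklore] `comp K₁ K₂ x z g f = applyK K₁ (fun y h => K₂ y z h f) x g` — definitional. -/
theorem comp_eq_applyK (K₁ K₂ : MKer d F) (x z : Site d) (g f : F) :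
    comp K₁ K₂ x z g f = applyK K₁ (fun y h => K₂ y z h f) x g := rfl

omit [Fintype F] in
/-- [folklore] The two spellings of one profile: `κ ∕ N · E = κ · E ∕ N`. -/
theorem profile_mul_div_comm (κ N E : ℝ) : κ / N * E = κ * E / N := by
  rw [div_mul_eq_mul_div]

omit [Fintype F] in
/-- [folklore] `e^{−ε‖x−y‖∞} = e^{−ε‖y−x‖∞}`. -/
theorem exp_supNorm_sub_comm (ε : ℝ) (x y : Site d) :
    Real.exp (-ε * supNorm (x - y)) = Real.exp (-ε * supNorm (y - x)) := by
  rw [← supNorm_neg (x - y), neg_sub]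

omit [Fintype F] in
/-- [folklore] Weakening the damping rate: `e^{−ε t} ≤ e^{−ε′ t}` for `ε′ ≤ ε`, `t ≥ 0`. -/
theorem exp_damp_mono {ε ε' t : ℝ} (hε' : ε' ≤ ε) (ht : 0 ≤ t) : Real.exp (-ε * t) ≤ Real.exp (-ε' * t) :=
  Real.exp_le_exp.mpr (by nlinarith)

/-! ## §1 The majorant engine: fibre sum out, uniform partial sums, `tsum` -/

section Majorant

/-- [folklore] **THE MAJORANT ENGINE, PARTIAL SUMS**: fibrewise majorants `|K₁ x y g h| ≤ M₁ y` (`M₁ ≥ 0`), `|K₂ y z h f| ≤ M₂ y` and a uniform bound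
`Σ_{y∈S} |M₁ y·M₂ y| ≤ Bnd` on all finite `S` give `Σ_{y∈S} |Σ_h K₁ x y g h·K₂ y z h f| ≤ |F|·Bnd`. -/
theorem sum_abs_compTerm_le_of_majorants {K₁ K₂ : MKer d F} {x z : Site d} {g f : F} {M₁ M₂ : Site d → ℝ} {Bnd : ℝ}
    (hM₁ : ∀ y, 0 ≤ M₁ y) (hK₁ : ∀ y h, |K₁ x y g h| ≤ M₁ y) (hK₂ : ∀ y h, |K₂ y z h f| ≤ M₂ y)
    (hB : ∀ S : Finset (Site d), ∑ y ∈ S, |M₁ y * M₂ y| ≤ Bnd) (S : Finset (Site d)) :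
    ∑ y ∈ S, |∑ h, K₁ x y g h * K₂ y z h f| ≤ Fintype.card F * Bnd := by
  calc ∑ y ∈ S, |∑ h, K₁ x y g h * K₂ y z h f| ≤ ∑ y ∈ S, Fintype.card F * (M₁ y * M₂ y) :=
        Finset.sum_le_sum fun y _ =>
          abs_sum_fibre_mul_le (ψ := fun y h => K₁ x y g h) (χ := fun y h => K₂ y z h f) (hM₁ y) y (hK₁ y) (hK₂ y)
    _ ≤ ∑ y ∈ S, Fintype.card F * |M₁ y * M₂ y| :=
        Finset.sum_le_sum fun y _ => mul_le_mul_of_nonneg_left (le_abs_self _) (Nat.cast_nonneg _)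
    _ = Fintype.card F * ∑ y ∈ S, |M₁ y * M₂ y| := by rw [Finset.mul_sum]
    _ ≤ Fintype.card F * Bnd := mul_le_mul_of_nonneg_left (hB S) (Nat.cast_nonneg _)

/-- [folklore] **THE MAJORANT ENGINE, `tsum` FORM**: under the same data the middle sum of `comp K₁ K₂ x z g f` is summable and
`|comp K₁ K₂ x z g f| ≤ |F|·Bnd` (leaf-04's `LatticeHLSProfiles.summable_and_abs_tsum_le_of_abs_sum_le`). -/
theorem summable_and_abs_comp_le_of_majorants {K₁ K₂ : MKer d F} {x z : Site d} {g f : F} {M₁ M₂ : Site d → ℝ} {Bnd : ℝ}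
    (hM₁ : ∀ y, 0 ≤ M₁ y) (hK₁ : ∀ y h, |K₁ x y g h| ≤ M₁ y) (hK₂ : ∀ y h, |K₂ y z h f| ≤ M₂ y)
    (hB : ∀ S : Finset (Site d), ∑ y ∈ S, |M₁ y * M₂ y| ≤ Bnd) :
    (Summable fun y => ∑ h, K₁ x y g h * K₂ y z h f) ∧ |comp K₁ K₂ x z g f| ≤ Fintype.card F * Bnd :=
  summable_and_abs_tsum_le_of_abs_sum_le (sum_abs_compTerm_le_of_majorants hM₁ hK₁ hK₂ hB)

end Majorant

/-! ## §2 (C2) Two singular centres, super-critical: a damped profile of exponent `a + b − d` -/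

section SuperCritical

/-- [folklore] (C2) data: the super-critical pair of damped profiles feeds the majorant engine with
`Bnd = κ₁·κ₂·C_d·e^{−ε‖x−z‖∞}∕nrm(x−z)^{a+b−d}` (leaf-04's `LatticeHLSDamped.abs_sum_mul_le_of_damped_profiles` at centres `(x, z)`). -/
theorem summable_and_abs_comp_le_of_profiles_super (hd : 0 < d) {a b : ℕ} (ha : a ≤ d - 1) (hb : b ≤ d - 1) (hab : d + 1 ≤ a + b)
    {K₁ K₂ : MKer d F} {κ₁ κ₂ ε : ℝ} (hκ₁ : 0 ≤ κ₁) (hκ₂ : 0 ≤ κ₂) (hε : 0 ≤ ε)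
    (hK₁ : ∀ x y g h, |K₁ x y g h| ≤ κ₁ / nrm (x - y) ^ a * Real.exp (-ε * supNorm (x - y)))
    (hK₂ : ∀ y z h f, |K₂ y z h f| ≤ κ₂ / nrm (y - z) ^ b * Real.exp (-ε * supNorm (y - z)))
    (x z : Site d) (g f : F) :
    (Summable fun y => ∑ h, K₁ x y g h * K₂ y z h f) ∧
      |comp K₁ K₂ x z g f| ≤ Fintype.card F *
        (κ₁ * κ₂ * (d * 2 ^ (d + 3) * 9 ^ (d - 1)) * Real.exp (-ε * supNorm (x - z)) / nrm (x - z) ^ (a + b - d)) := by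
  refine summable_and_abs_comp_le_of_majorants
    (M₁ := fun y => κ₁ * Real.exp (-ε * supNorm (y - x)) / nrm (y - x) ^ a)
    (M₂ := fun y => κ₂ * Real.exp (-ε * supNorm (y - z)) / nrm (y - z) ^ b)
    (fun y => by have := nrm_pos (y - x); positivity) (fun y h => ?_) (fun y h => ?_) (fun S => ?_)
  · rw [← profile_mul_div_comm, ← exp_supNorm_sub_comm, show nrm (y - x) = nrm (x - y) by rw [← nrm_neg (y - x), neg_sub]]
    exact hK₁ x y g h
  · rw [← profile_mul_div_comm]; exact hK₂ y z h f
  · exact abs_sum_mul_le_of_damped_profiles hd ha hb hab hκ₁ hκ₂ hε S x z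
      (fun y _ => by rw [abs_of_nonneg (by have := nrm_pos (y - x); positivity)])
      (fun y _ => by rw [abs_of_nonneg (by have := nrm_pos (y - z); positivity)])

/-- [folklore] **(C2) TWO SINGULAR CENTRES, SUPER-CRITICAL** (`a, b ≤ d−1`, `d+1 ≤ a+b`; `κ₁, κ₂, ε ≥ 0`): damped entry profiles
`|K₁ x y g h| ≤ κ₁∕nrm(x−y)^a·e^{−ε‖x−y‖∞}`, `|K₂ y z h f| ≤ κ₂∕nrm(y−z)^b·e^{−ε‖y−z‖∞}` give, at EVERY `x z g f`,
`|comp K₁ K₂ x z g f| ≤ (|F|·κ₁·κ₂·(d·2^{d+3}·9^{d−1}))∕nrm(x−z)^{a+b−d}·e^{−ε‖x−z‖∞}` — a damped profile again, in the leg-profile shape. -/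
theorem abs_comp_le_of_profiles_super (hd : 0 < d) {a b : ℕ} (ha : a ≤ d - 1) (hb : b ≤ d - 1) (hab : d + 1 ≤ a + b)
    {K₁ K₂ : MKer d F} {κ₁ κ₂ ε : ℝ} (hκ₁ : 0 ≤ κ₁) (hκ₂ : 0 ≤ κ₂) (hε : 0 ≤ ε)
    (hK₁ : ∀ x y g h, |K₁ x y g h| ≤ κ₁ / nrm (x - y) ^ a * Real.exp (-ε * supNorm (x - y)))
    (hK₂ : ∀ y z h f, |K₂ y z h f| ≤ κ₂ / nrm (y - z) ^ b * Real.exp (-ε * supNorm (y - z)))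
    (x z : Site d) (g f : F) :
    |comp K₁ K₂ x z g f| ≤ (Fintype.card F * κ₁ * κ₂ * (d * 2 ^ (d + 3) * 9 ^ (d - 1))) / nrm (x - z) ^ (a + b - d)
        * Real.exp (-ε * supNorm (x - z)) := by
  have h := (summable_and_abs_comp_le_of_profiles_super hd ha hb hab hκ₁ hκ₂ hε hK₁ hK₂ x z g f).2
  have hn := nrm_pos (x - z)
  calc |comp K₁ K₂ x z g f| ≤ _ := h
    _ = _ := by field_simp

end SuperCritical

/-! ## §3 (C1) One singular centre against a flat damped factor: a FLAT output, damped at half the rate -/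

section SingularFlat

/-- [folklore] (C1) data: SINGULAR × FLAT (`K₁` exponent `a ≤ d−1` at the left end `x`, `K₂` flat at the right end `z`; `ε > 0`) feeds the majorant
engine with `Bnd = κ₁·κ₂·e^{−(ε∕2)‖x−z‖∞}·B_{d,a}(ε)` (leaf-04's `LatticeHLSDamped.abs_sum_mul_le_of_damped_flat` at centres `(x, z)`). -/
theorem summable_and_abs_comp_le_of_profiles_singular_flat (hd : 0 < d) {a : ℕ} (ha : a ≤ d - 1)
    {K₁ K₂ : MKer d F} {κ₁ κ₂ ε : ℝ} (hκ₁ : 0 ≤ κ₁) (hκ₂ : 0 ≤ κ₂) (hε : 0 < ε)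
    (hK₁ : ∀ x y g h, |K₁ x y g h| ≤ κ₁ / nrm (x - y) ^ a * Real.exp (-ε * supNorm (x - y)))
    (hK₂ : ∀ y z h f, |K₂ y z h f| ≤ κ₂ * Real.exp (-ε * supNorm (y - z)))
    (x z : Site d) (g f : F) :
    (Summable fun y => ∑ h, K₁ x y g h * K₂ y z h f) ∧
      |comp K₁ K₂ x z g f| ≤ Fintype.card F * (κ₁ * κ₂ * Real.exp (-(ε / 2) * supNorm (x - z)) *
        (1 + 2 * d * 3 ^ (d - 1) * ((d - 1 - a).factorial * (2 / (ε / 2)) ^ (d - 1 - a) * (1 + 2 / (ε / 2))))) := by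
  refine summable_and_abs_comp_le_of_majorants
    (M₁ := fun y => κ₁ * Real.exp (-ε * supNorm (y - x)) / nrm (y - x) ^ a)
    (M₂ := fun y => κ₂ * Real.exp (-ε * supNorm (y - z)))
    (fun y => by have := nrm_pos (y - x); positivity) (fun y h => ?_) (fun y h => hK₂ y z h f) (fun S => ?_)
  · rw [← profile_mul_div_comm, ← exp_supNorm_sub_comm, show nrm (y - x) = nrm (x - y) by rw [← nrm_neg (y - x), neg_sub]]
    exact hK₁ x y g h
  · exact abs_sum_mul_le_of_damped_flat hd ha hκ₁ hκ₂ hε S x z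
      (fun y _ => by rw [abs_of_nonneg (by have := nrm_pos (y - x); positivity)])
      (fun y _ => by rw [abs_of_nonneg (by positivity)])

/-- [folklore] (C1′) data: FLAT × SINGULAR (`K₁` flat at the left end `x`, `K₂` exponent `b ≤ d−1` at the right end `z`; `ε > 0`), same `Bnd` with
`B_{d,b}(ε)` (the engine at centres `(z, x)`, the product commuted). -/
theorem summable_and_abs_comp_le_of_profiles_flat_singular (hd : 0 < d) {b : ℕ} (hb : b ≤ d - 1)
    {K₁ K₂ : MKer d F} {κ₁ κ₂ ε : ℝ} (hκ₁ : 0 ≤ κ₁) (hκ₂ : 0 ≤ κ₂) (hε : 0 < ε)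
    (hK₁ : ∀ x y g h, |K₁ x y g h| ≤ κ₁ * Real.exp (-ε * supNorm (x - y)))
    (hK₂ : ∀ y z h f, |K₂ y z h f| ≤ κ₂ / nrm (y - z) ^ b * Real.exp (-ε * supNorm (y - z)))
    (x z : Site d) (g f : F) :
    (Summable fun y => ∑ h, K₁ x y g h * K₂ y z h f) ∧
      |comp K₁ K₂ x z g f| ≤ Fintype.card F * (κ₂ * κ₁ * Real.exp (-(ε / 2) * supNorm (z - x)) *
        (1 + 2 * d * 3 ^ (d - 1) * ((d - 1 - b).factorial * (2 / (ε / 2)) ^ (d - 1 - b) * (1 + 2 / (ε / 2))))) := by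
  refine summable_and_abs_comp_le_of_majorants
    (M₁ := fun y => κ₁ * Real.exp (-ε * supNorm (y - x)))
    (M₂ := fun y => κ₂ * Real.exp (-ε * supNorm (y - z)) / nrm (y - z) ^ b)
    (fun y => by positivity) (fun y h => ?_) (fun y h => ?_) (fun S => ?_)
  · rw [← exp_supNorm_sub_comm]; exact hK₁ x y g h
  · rw [← profile_mul_div_comm]; exact hK₂ y z h f
  · have h1 := abs_sum_mul_le_of_damped_flat hd hb hκ₂ hκ₁ hε S z x
      (K := fun y => κ₂ * Real.exp (-ε * supNorm (y - z)) / nrm (y - z) ^ b)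
      (f := fun y => κ₁ * Real.exp (-ε * supNorm (y - x)))
      (fun y _ => by rw [abs_of_nonneg (by have := nrm_pos (y - z); positivity)])
      (fun y _ => by rw [abs_of_nonneg (by positivity)])
    refine le_trans (le_of_eq (Finset.sum_congr rfl fun y _ => by rw [mul_comm])) h1

/-- [folklore] **(C1) SINGULAR × FLAT** (`K₁` exponent `a ≤ d−1`, `K₂` flat; `κ₁, κ₂ ≥ 0`, `ε > 0`):
`|comp K₁ K₂ x z g f| ≤ |F|·κ₁·κ₂·(1 + 2d·3^{d−1}·((d−1−a)!·(4∕ε)^{d−1−a}·(1+4∕ε)))·e^{−(ε∕2)‖x−z‖∞}`. -/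
theorem abs_comp_le_of_profiles_singular_flat (hd : 0 < d) {a : ℕ} (ha : a ≤ d - 1)
    {K₁ K₂ : MKer d F} {κ₁ κ₂ ε : ℝ} (hκ₁ : 0 ≤ κ₁) (hκ₂ : 0 ≤ κ₂) (hε : 0 < ε)
    (hK₁ : ∀ x y g h, |K₁ x y g h| ≤ κ₁ / nrm (x - y) ^ a * Real.exp (-ε * supNorm (x - y)))
    (hK₂ : ∀ y z h f, |K₂ y z h f| ≤ κ₂ * Real.exp (-ε * supNorm (y - z)))
    (x z : Site d) (g f : F) :
    |comp K₁ K₂ x z g f| ≤ Fintype.card F * κ₁ * κ₂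
        * (1 + 2 * d * 3 ^ (d - 1) * ((d - 1 - a).factorial * (4 / ε) ^ (d - 1 - a) * (1 + 4 / ε)))
        * Real.exp (-(ε / 2) * supNorm (x - z)) := by
  have h := (summable_and_abs_comp_le_of_profiles_singular_flat hd ha hκ₁ hκ₂ hε hK₁ hK₂ x z g f).2
  have e4 : (2 : ℝ) / (ε / 2) = 4 / ε := by field_simp; ring
  rw [e4] at h
  calc |comp K₁ K₂ x z g f| ≤ _ := h
    _ = _ := by ring

/-- [folklore] **(C1′) FLAT × SINGULAR** (`K₁` flat, `K₂` exponent `b ≤ d−1`; `κ₁, κ₂ ≥ 0`, `ε > 0`):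
`|comp K₁ K₂ x z g f| ≤ |F|·κ₁·κ₂·(1 + 2d·3^{d−1}·((d−1−b)!·(4∕ε)^{d−1−b}·(1+4∕ε)))·e^{−(ε∕2)‖x−z‖∞}`. -/
theorem abs_comp_le_of_profiles_flat_singular (hd : 0 < d) {b : ℕ} (hb : b ≤ d - 1)
    {K₁ K₂ : MKer d F} {κ₁ κ₂ ε : ℝ} (hκ₁ : 0 ≤ κ₁) (hκ₂ : 0 ≤ κ₂) (hε : 0 < ε)
    (hK₁ : ∀ x y g h, |K₁ x y g h| ≤ κ₁ * Real.exp (-ε * supNorm (x - y)))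
    (hK₂ : ∀ y z h f, |K₂ y z h f| ≤ κ₂ / nrm (y - z) ^ b * Real.exp (-ε * supNorm (y - z)))
    (x z : Site d) (g f : F) :
    |comp K₁ K₂ x z g f| ≤ Fintype.card F * κ₁ * κ₂
        * (1 + 2 * d * 3 ^ (d - 1) * ((d - 1 - b).factorial * (4 / ε) ^ (d - 1 - b) * (1 + 4 / ε)))
        * Real.exp (-(ε / 2) * supNorm (x - z)) := by
  have h := (summable_and_abs_comp_le_of_profiles_flat_singular hd hb hκ₁ hκ₂ hε hK₁ hK₂ x z g f).2
  have e4 : (2 : ℝ) / (ε / 2) = 4 / ε := by field_simp; ring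
  rw [e4, exp_supNorm_sub_comm (ε / 2) z x] at h
  calc |comp K₁ K₂ x z g f| ≤ _ := h
    _ = _ := by ring

omit [Fintype F] in
/-- [folklore] Rescaling a flat bound: `t ≤ A·B₁·E`, `B₁ ≤ B₂·P`, `A, E ≥ 0` ⟹ `t ≤ (A·B₂·P)∕N^0·E` (the leg-profile shape with exponent `0`). -/
theorem flat_profile_rescale {t A B₁ B₂ P E N : ℝ} (h : t ≤ A * B₁ * E) (hB : B₁ ≤ B₂ * P) (hA : 0 ≤ A) (hE : 0 ≤ E) :
    t ≤ (A * B₂ * P) / N ^ 0 * E := by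
  rw [pow_zero, div_one, mul_assoc A B₂ P]
  exact h.trans (mul_le_mul_of_nonneg_right (mul_le_mul_of_nonneg_left hB hA) hE)

omit [Fintype F] in
/-- [folklore] The scale-`n` constant: at `ε = δ∕n`, `n ≥ 1`, `a ≤ d−1`:
`1 + 2d·3^{d−1}·((d−1−a)!·(4∕(δ∕n))^{d−1−a}·(1+4∕(δ∕n))) ≤ (1 + 2d·3^{d−1}·((d−1−a)!·(4∕δ)^{d−1−a}·(1+4∕δ)))·n^{d−a}`. -/
theorem bracket_scale_le (hd : 0 < d) {a : ℕ} (ha : a ≤ d - 1) {δ : ℝ} (hδ : 0 < δ) {n : ℕ} (hn : 1 ≤ n) :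
    1 + 2 * (d : ℝ) * 3 ^ (d - 1) * ((d - 1 - a).factorial * (4 / (δ / n)) ^ (d - 1 - a) * (1 + 4 / (δ / n)))
      ≤ (1 + 2 * d * 3 ^ (d - 1) * ((d - 1 - a).factorial * (4 / δ) ^ (d - 1 - a) * (1 + 4 / δ))) * (n : ℝ) ^ (d - a) := by
  have hn1 : (1 : ℝ) ≤ n := by exact_mod_cast hn
  have hn0 : (0 : ℝ) < n := by linarith
  have hpow : (n : ℝ) ^ (d - 1 - a) * n = (n : ℝ) ^ (d - a) := by rw [← pow_succ]; congr 1; omega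
  have h1 : (1 : ℝ) + 4 / δ * n ≤ (1 + 4 / δ) * n := by have : (0 : ℝ) ≤ 4 / δ := (by positivity); nlinarith
  have hnd : (1 : ℝ) ≤ (n : ℝ) ^ (d - a) := one_le_pow₀ hn1
  rw [show (4 : ℝ) / (δ / n) = 4 / δ * n by field_simp, mul_pow]
  calc 1 + 2 * (d : ℝ) * 3 ^ (d - 1) * ((d - 1 - a).factorial * ((4 / δ) ^ (d - 1 - a) * (n : ℝ) ^ (d - 1 - a)) * (1 + 4 / δ * n))
      ≤ 1 + 2 * (d : ℝ) * 3 ^ (d - 1) * ((d - 1 - a).factorial * ((4 / δ) ^ (d - 1 - a) * (n : ℝ) ^ (d - 1 - a)) * ((1 + 4 / δ) * n)) := by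
        gcongr
    _ = 1 + 2 * (d : ℝ) * 3 ^ (d - 1) * ((d - 1 - a).factorial * (4 / δ) ^ (d - 1 - a) * (1 + 4 / δ)) * ((n : ℝ) ^ (d - 1 - a) * n) := by ring
    _ = 1 + 2 * (d : ℝ) * 3 ^ (d - 1) * ((d - 1 - a).factorial * (4 / δ) ^ (d - 1 - a) * (1 + 4 / δ)) * (n : ℝ) ^ (d - a) := by rw [hpow]
    _ ≤ (n : ℝ) ^ (d - a) + 2 * (d : ℝ) * 3 ^ (d - 1) * ((d - 1 - a).factorial * (4 / δ) ^ (d - 1 - a) * (1 + 4 / δ)) * (n : ℝ) ^ (d - a) := by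
        linarith
    _ = _ := by ring

/-- [folklore] **(C1) AT SCALE `n`** (`ε = δ∕n`, `n ≥ 1`): singular × flat gives the FLAT damped profile
`|comp K₁ K₂ x z g f| ≤ (|F|·κ₁·κ₂·B_{d,a}(δ)·n^{d−a})∕nrm(x−z)^0·e^{−(δ∕2∕n)‖x−z‖∞}` — written in the leg-profile shape (exponent `0`) so that it
feeds `ProfileWordFamilies.abs_biBubble_le_of_profiles` BY NAME. -/
theorem abs_comp_le_of_profiles_singular_flat_scale (hd : 0 < d) {a : ℕ} (ha : a ≤ d - 1) {δ : ℝ} (hδ : 0 < δ) {n : ℕ} (hn : 1 ≤ n)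
    {K₁ K₂ : MKer d F} {κ₁ κ₂ : ℝ} (hκ₁ : 0 ≤ κ₁) (hκ₂ : 0 ≤ κ₂)
    (hK₁ : ∀ x y g h, |K₁ x y g h| ≤ κ₁ / nrm (x - y) ^ a * Real.exp (-(δ / n) * supNorm (x - y)))
    (hK₂ : ∀ y z h f, |K₂ y z h f| ≤ κ₂ * Real.exp (-(δ / n) * supNorm (y - z)))
    (x z : Site d) (g f : F) :
    |comp K₁ K₂ x z g f|
      ≤ (Fintype.card F * κ₁ * κ₂ * (1 + 2 * d * 3 ^ (d - 1) * ((d - 1 - a).factorial * (4 / δ) ^ (d - 1 - a) * (1 + 4 / δ)))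
          * (n : ℝ) ^ (d - a)) / nrm (x - z) ^ 0 * Real.exp (-(δ / 2 / n) * supNorm (x - z)) := by
  have hn0 : (0 : ℝ) < n := by exact_mod_cast hn
  have h := abs_comp_le_of_profiles_singular_flat hd ha hκ₁ hκ₂ (by positivity : 0 < δ / n) hK₁ hK₂ x z g f
  rw [show δ / n / 2 = δ / 2 / n by ring] at h
  exact flat_profile_rescale h (bracket_scale_le hd ha hδ hn) (by positivity) (Real.exp_pos _).le

/-- [folklore] **(C1′) AT SCALE `n`** (`ε = δ∕n`, `n ≥ 1`): flat × singular, same flat output with `B_{d,b}(δ)·n^{d−b}`. -/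
theorem abs_comp_le_of_profiles_flat_singular_scale (hd : 0 < d) {b : ℕ} (hb : b ≤ d - 1) {δ : ℝ} (hδ : 0 < δ) {n : ℕ} (hn : 1 ≤ n)
    {K₁ K₂ : MKer d F} {κ₁ κ₂ : ℝ} (hκ₁ : 0 ≤ κ₁) (hκ₂ : 0 ≤ κ₂)
    (hK₁ : ∀ x y g h, |K₁ x y g h| ≤ κ₁ * Real.exp (-(δ / n) * supNorm (x - y)))
    (hK₂ : ∀ y z h f, |K₂ y z h f| ≤ κ₂ / nrm (y - z) ^ b * Real.exp (-(δ / n) * supNorm (y - z)))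
    (x z : Site d) (g f : F) :
    |comp K₁ K₂ x z g f|
      ≤ (Fintype.card F * κ₁ * κ₂ * (1 + 2 * d * 3 ^ (d - 1) * ((d - 1 - b).factorial * (4 / δ) ^ (d - 1 - b) * (1 + 4 / δ)))
          * (n : ℝ) ^ (d - b)) / nrm (x - z) ^ 0 * Real.exp (-(δ / 2 / n) * supNorm (x - z)) := by
  have hn0 : (0 : ℝ) < n := by exact_mod_cast hn
  have h := abs_comp_le_of_profiles_flat_singular hd hb hκ₁ hκ₂ (by positivity : 0 < δ / n) hK₁ hK₂ x z g f
  rw [show δ / n / 2 = δ / 2 / n by ring] at h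
  exact flat_profile_rescale h (bracket_scale_le hd hb hδ hn) (by positivity) (Real.exp_pos _).le

end SingularFlat

/-! ## §4 (C3) Right differences commute with the left factor -/

section RightDifference

/-- [folklore] **(C3) LINEARITY IN THE RIGHT FACTOR UNDER SUMMABILITY**: if the two middle sums converge,
`comp K₁ K₂ x z′ g f − comp K₁ K₂′ x z g f = Σ'_y Σ_h K₁ x y g h · (K₂ y z′ h f − K₂′ y z h f)`. -/
theorem comp_sub_right {K₁ K₂ K₂' : MKer d F} {x z z' : Site d} {g f : F}
    (h₁ : Summable fun y => ∑ h, K₁ x y g h * K₂ y z' h f) (h₂ : Summable fun y => ∑ h, K₁ x y g h * K₂' y z h f) :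
    comp K₁ K₂ x z' g f - comp K₁ K₂' x z g f = ∑' y, ∑ h, K₁ x y g h * (K₂ y z' h f - K₂' y z h f) := by
  unfold ExpKernelCalculus.comp
  rw [← h₁.tsum_sub h₂]
  exact tsum_congr fun y => by rw [← Finset.sum_sub_distrib]; exact Finset.sum_congr rfl fun h _ => by ring

/-- [folklore] **(C3) THE RIGHT DIFFERENCE OF A COMPOSITE IS THE COMPOSITE WITH THE RIGHT DIFFERENCE**:
`comp K₁ K₂ x (z + e) g f − comp K₁ K₂ x z g f = comp K₁ (fun y w h k => K₂ y (w + e) h k − K₂ y w h k) x z g f`, under the two summabilities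
(which §2∕§3's `summable_and_…` lemmas supply) — so the right-difference profile of a composite is (C1)∕(C2)
applied to `(K₁, D_e K₂)`; no new count. -/
theorem comp_shift_sub_eq_comp_diff {K₁ K₂ : MKer d F} {x z e : Site d} {g f : F}
    (h₁ : Summable fun y => ∑ h, K₁ x y g h * K₂ y (z + e) h f) (h₂ : Summable fun y => ∑ h, K₁ x y g h * K₂ y z h f) :
    comp K₁ K₂ x (z + e) g f - comp K₁ K₂ x z g f = comp K₁ (fun y w h k => K₂ y (w + e) h k - K₂ y w h k) x z g f := by
  rw [comp_sub_right h₁ h₂]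
  rfl

/-- [folklore] The same for the LEFT END (difference in `x`), with no summability juggling beyond the two middle sums:
`comp K₁ K₂ (x + e) z g f − comp K₁ K₂ x z g f = comp (fun v y k h => K₁ (v + e) y k h − K₁ v y k h) K₂ x z g f`. -/
theorem comp_shift_left_sub_eq_comp_diff {K₁ K₂ : MKer d F} {x z e : Site d} {g f : F}
    (h₁ : Summable fun y => ∑ h, K₁ (x + e) y g h * K₂ y z h f) (h₂ : Summable fun y => ∑ h, K₁ x y g h * K₂ y z h f) :
    comp K₁ K₂ (x + e) z g f - comp K₁ K₂ x z g f = comp (fun v y k h => K₁ (v + e) y k h - K₁ v y k h) K₂ x z g f := by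
  unfold ExpKernelCalculus.comp
  rw [← h₁.tsum_sub h₂]
  exact tsum_congr fun y => by rw [← Finset.sum_sub_distrib]; exact Finset.sum_congr rfl fun h _ => by ring

end RightDifference

/-! ## §5 (C4) The one-power trade and the critical reading -/

section Trade

omit [Fintype F] in
/-- [folklore] `nrm(v)·e^{−(ε∕2)‖v‖∞} ≤ 1 + 2∕ε` (`ε > 0`): `nrm ≤ 1 + ‖v‖∞` and `t·e^{−(ε∕2)t} ≤ (2∕(ε∕2))∕…` via leaf-04's `pow_mul_exp_neg_le`
at `k = 1` … here in the elementary form `t·e^{−εt} ≤ (2∕ε)·e^{−(ε∕2)t}`. -/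
theorem nrm_mul_exp_le {ε : ℝ} (hε : 0 < ε) (v : Site d) :
    nrm v * Real.exp (-ε * supNorm v) ≤ (1 + 2 / ε) * Real.exp (-(ε / 2) * supNorm v) := by
  have ht : (0 : ℝ) ≤ (supNorm v : ℝ) := Nat.cast_nonneg _
  have h1 := pow_mul_exp_neg_le hε 1 ht
  simp only [pow_one, Nat.factorial_one, Nat.cast_one, one_mul] at h1
  have hnrm : nrm v ≤ 1 + (supNorm v : ℝ) := by
    unfold PoissonInterior.nrm
    exact max_le (by linarith) (by linarith)
  have hexp : Real.exp (-ε * supNorm v) ≤ Real.exp (-(ε / 2) * supNorm v) := exp_damp_mono (by linarith) ht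
  have hpos : 0 < Real.exp (-ε * supNorm v) := Real.exp_pos _
  calc nrm v * Real.exp (-ε * supNorm v) ≤ (1 + (supNorm v : ℝ)) * Real.exp (-ε * supNorm v) :=
        mul_le_mul_of_nonneg_right hnrm hpos.le
    _ = Real.exp (-ε * supNorm v) + (supNorm v : ℝ) * Real.exp (-ε * supNorm v) := by ring
    _ ≤ Real.exp (-(ε / 2) * supNorm v) + 2 / ε * Real.exp (-(ε / 2) * supNorm v) := add_le_add hexp h1
    _ = _ := by ring

omit [Fintype F] in
/-- [folklore] **(C4) THE ONE-POWER TRADE**: `1∕nrm(v)^b·e^{−ε‖v‖∞} ≤ (1 + 2∕ε)·(1∕nrm(v)^{b+1}·e^{−(ε∕2)‖v‖∞})` (`ε > 0`) — one more Riesz power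
for half the damping (at `ε = δ∕n`: constant `1 + 2n∕δ`). -/
theorem profile_trade_one_power {ε : ℝ} (hε : 0 < ε) (b : ℕ) (v : Site d) :
    1 / nrm v ^ b * Real.exp (-ε * supNorm v) ≤ (1 + 2 / ε) * (1 / nrm v ^ (b + 1) * Real.exp (-(ε / 2) * supNorm v)) := by
  have hn := nrm_pos v
  have h := nrm_mul_exp_le hε v
  have e : 1 / nrm v ^ b * Real.exp (-ε * supNorm v) = 1 / nrm v ^ (b + 1) * (nrm v * Real.exp (-ε * supNorm v)) := by
    rw [pow_succ]; field_simp
  rw [e]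
  calc 1 / nrm v ^ (b + 1) * (nrm v * Real.exp (-ε * supNorm v))
      ≤ 1 / nrm v ^ (b + 1) * ((1 + 2 / ε) * Real.exp (-(ε / 2) * supNorm v)) :=
        mul_le_mul_of_nonneg_left h (by positivity)
    _ = _ := by ring

/-- [folklore] **THE CRITICAL PAIR BY TRADING ONE POWER** (`a ≤ d−1`, `b+1 ≤ d−1`, `a + b = d`; `κ₁, κ₂ ≥ 0`, `ε > 0`): profiles
`κ₁∕nrm^a·e^{−ε‖·‖}` and `κ₂∕nrm^b·e^{−ε‖·‖}` give `|comp K₁ K₂ x z g f| ≤ (|F|·κ₁·(κ₂·(1 + 2∕ε))·(d·2^{d+3}·9^{d−1}))∕nrm(x−z)·e^{−(ε∕2)‖x−z‖∞}`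
((C4) on `K₂`, the rate of `K₁` weakened to `ε∕2`, then (C2) at `a + (b+1) = d + 1`; at `ε = δ∕n` the constant carries `1 + 2n∕δ` — the `G∘G` value of
GHOST-N8-SPEC v0.2 (O5)). -/
theorem abs_comp_le_of_profiles_crit_trade (hd : 0 < d) {a b : ℕ} (ha : a ≤ d - 1) (hb1 : b + 1 ≤ d - 1) (hab : a + b = d)
    {K₁ K₂ : MKer d F} {κ₁ κ₂ ε : ℝ} (hκ₁ : 0 ≤ κ₁) (hκ₂ : 0 ≤ κ₂) (hε : 0 < ε)
    (hK₁ : ∀ x y g h, |K₁ x y g h| ≤ κ₁ / nrm (x - y) ^ a * Real.exp (-ε * supNorm (x - y)))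
    (hK₂ : ∀ y z h f, |K₂ y z h f| ≤ κ₂ / nrm (y - z) ^ b * Real.exp (-ε * supNorm (y - z)))
    (x z : Site d) (g f : F) :
    |comp K₁ K₂ x z g f| ≤ (Fintype.card F * κ₁ * (κ₂ * (1 + 2 / ε)) * (d * 2 ^ (d + 3) * 9 ^ (d - 1))) / nrm (x - z) ^ 1
        * Real.exp (-(ε / 2) * supNorm (x - z)) := by
  have hε2 : 0 ≤ ε / 2 := by positivity
  have htrade : 0 ≤ 1 + 2 / ε := by positivity
  -- weaken `K₁`'s damping to `ε∕2`
  have hK₁' : ∀ x y g h, |K₁ x y g h| ≤ κ₁ / nrm (x - y) ^ a * Real.exp (-(ε / 2) * supNorm (x - y)) := by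
    intro x y g h
    refine (hK₁ x y g h).trans ?_
    have := nrm_pos (x - y)
    exact mul_le_mul_of_nonneg_left (exp_damp_mono (by linarith) (Nat.cast_nonneg _)) (by positivity)
  -- trade one power on `K₂`
  have hK₂' : ∀ y z h f, |K₂ y z h f| ≤ κ₂ * (1 + 2 / ε) / nrm (y - z) ^ (b + 1) * Real.exp (-(ε / 2) * supNorm (y - z)) := by
    intro y z h f
    refine (hK₂ y z h f).trans ?_
    have hn := nrm_pos (y - z)
    have ht := profile_trade_one_power hε b (y - z)
    calc κ₂ / nrm (y - z) ^ b * Real.exp (-ε * supNorm (y - z)) = κ₂ * (1 / nrm (y - z) ^ b * Real.exp (-ε * supNorm (y - z))) := by ring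
      _ ≤ κ₂ * ((1 + 2 / ε) * (1 / nrm (y - z) ^ (b + 1) * Real.exp (-(ε / 2) * supNorm (y - z)))) :=
          mul_le_mul_of_nonneg_left ht hκ₂
      _ = _ := by ring
  have hsum : d + 1 ≤ a + (b + 1) := by omega
  have h := abs_comp_le_of_profiles_super hd ha hb1 hsum hκ₁ (by positivity) hε2 hK₁' hK₂' x z g f
  have e1 : a + (b + 1) - d = 1 := by omega
  rw [e1] at h
  exact h

end Trade

end
end Summit.QuantumFields.BalabanUV.Gaps.ProfileLegComposition
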